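import Summits.Parity.BatemanHorn.Theorems.SelbergDelangeRigidityLSDRealSegmentTypeILocal
import Literature.NumberTheory.Sieve.BatemanHornMertensProduct
import Literature.NumberTheory.LFunctions.HallTenenbaumTheorem01
import Literature.NumberTheory.LFunctions.MertensElementary
import HarnessLib

/-!
# Route `SelbergDelangeRigidity`, crux `LSDRealSegment` (stmt-Parity-9770), line
# `product-anatomy-subcritical`: the right-hand side of Nair–Tenenbaum along a Bateman–Horn system (helper of `stub_tails`)

Two unconditional order-of-magnitude bounds needed to EVALUATE the right-hand side of the Nair–Tenenbaum bound
(`Literature.NumberTheory.Sieve.NairTenenbaum1998_theorem1`) along a Bateman–Horn system `f` with the (peeled)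
tilt `y^{Ω}`, `1 ≤ y < 2`:
* `tails_rootCountHarmonic_le` (registered helper): `Σ_{m ≤ N} y^{Ω(m)} ρⱼ(m)/m ≤ C (log N)^y` for every member
  `ρⱼ = polyRootCountMod ![f j]` — Hall–Tenenbaum (0.4) for the multiplicative weight `y^{Ω} ρⱼ`
  (`ρⱼ(p^a) ≤ Cⱼ` uniformly: `exists_polyRootCountMod_prime_pow_le_of_system`; the `p = 2` factor converges
  because `y < 2`), then `Σ_{p ≤ N} ρⱼ(p)/p ≤ log log N + O(1)` from Mertens and the PROVED convergence of
  `Σ_p (1 − ρⱼ(p))/p` (`AZFG2020_tendsto_sum_sub_omega_div_holds` for the one-member system `![f j]`);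
* `exists_prod_one_sub_rootCount_le`: `∏_{p ≤ N} (1 − ρ_F(p)/p) ≤ M (log N)^{−k}` (from the PROVED Mertens theorem
  along the system, `tendsto_log_pow_mul_prod_one_sub_rootCount`).
-/

open Filter Finset Polynomial
open scoped BigOperators Topology Classical

namespace Summit.Parity.BatemanHorn.Cruxes.LSDRealSegment.ProductAnatomySubcritical

open Literature.NumberTheory.Sieve
open ArithmeticFunction (cardFactors)
noncomputable section

variable {k : ℕ}

/-! ### The sieve product -/

/-- `∏_{p ≤ N} (1 − ρ_F(p)/p) ≤ M / (log N)^k` for `N ≥ 2` along a Bateman–Horn system. [folklore] -/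
theorem exists_prod_one_sub_rootCount_le {f : Fin k → ℤ[X]} (hf : IsBatemanHornSystem f) :
    ∃ M : ℝ, 0 ≤ M ∧ ∀ N : ℕ, 2 ≤ N →
      ∏ p ∈ Nat.primesLE N, (1 - (polyRootCountMod f p : ℝ) / p) ≤ M / Real.log N ^ k := by
  obtain ⟨M, hM⟩ := (BatemanHornMertens.tendsto_log_pow_mul_prod_one_sub_rootCount hf).bddAbove_range
  refine ⟨max M 0, le_max_right _ _, fun N hN => ?_⟩
  have hlog : 0 < Real.log N := Real.log_pos (by exact_mod_cast hN)
  have hle : Real.log N ^ k * ∏ p ∈ Nat.primesLE N, (1 - (polyRootCountMod f p : ℝ) / p) ≤ M := hM ⟨N, rfl⟩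
  rw [le_div_iff₀ (pow_pos hlog k), mul_comm]
  exact hle.trans (le_max_left _ _)

/-! ### The harmonic sum `Σ y^{Ω(m)} ρⱼ(m)/m` of one member -/

/-- For a one-polynomial Bateman–Horn system `![g]` and `1 ≤ y < 2`:
`Σ_{m ≤ N} y^{Ω(m)} ρ_g(m)/m ≤ C (log N)^y` for `N ≥ 2`. [folklore] -/
theorem exists_harmonic_rootCount_le_single {g : ℤ[X]} (hg : IsBatemanHornSystem ![g]) {y : ℝ}
    (hy : 1 ≤ y) (hy2 : y < 2) :
    ∃ C : ℝ, 0 ≤ C ∧ ∀ N : ℕ, 2 ≤ N →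
      ∑ m ∈ Icc 1 N, y ^ cardFactors m * (polyRootCountMod ![g] m : ℝ) / m ≤ C * Real.log N ^ y := by
  have hy0 : 0 ≤ y := by linarith
  obtain ⟨Cρ, hCρ⟩ := exists_polyRootCountMod_prime_pow_le_of_system hg
  obtain ⟨L, hL⟩ := AZFG2020_tendsto_sum_sub_omega_div_holds 1 ![g] hg
  obtain ⟨b, hb⟩ := hL.bddBelow_range
  have hlow : ∀ x : ℕ, b ≤ ∑ p ∈ Nat.primesLE x, (((1 : ℕ) : ℝ) - polyRootCountMod ![g] p) / p :=
    fun x => hb ⟨x, rfl⟩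
  set T₀ : ℝ := 4 / (1 - y / 2) with hT₀
  have h1y2 : 0 < 1 - y / 2 := by linarith
  have hT₀0 : 0 ≤ T₀ := by positivity
  -- the multiplicative weight `w(m) = y^{Ω(m)} ρ(m)`
  set w : ℕ → ℝ := fun m => y ^ cardFactors m * (polyRootCountMod ![g] m : ℝ) with hw
  have hw0 : ∀ m, 0 ≤ w m := fun m => by positivity
  have hw1 : w 1 = 1 := by simp [hw, polyRootCountMod_one]
  have hwmul : ∀ m n : ℕ, m.Coprime n → w (m * n) = w m * w n := by
    intro m n hmn
    rcases eq_or_ne m 0 with rfl | hm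
    · obtain rfl : n = 1 := by simpa using hmn
      simp [hw1]
    rcases eq_or_ne n 0 with rfl | hn
    · obtain rfl : m = 1 := by simpa using hmn
      simp [hw1]
    simp only [hw]
    rw [ArithmeticFunction.cardFactors_mul hm hn, pow_add, polyRootCountMod_mul_of_coprime_system _ hmn,
      Nat.cast_mul]
    ring
  -- local terms
  have hloc : ∀ p : ℕ, p.Prime → ∀ ν : ℕ, w (p ^ ν) / (p : ℝ) ^ ν ≤ Cρ * (y / p) ^ ν := by
    intro p hp ν
    have hp0 : (0 : ℝ) < p := by exact_mod_cast hp.pos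
    simp only [hw]
    rw [ArithmeticFunction.cardFactors_apply_prime_pow hp, div_pow]
    have h1 : (polyRootCountMod ![g] (p ^ ν) : ℝ) ≤ Cρ := by exact_mod_cast hCρ p hp ν
    calc y ^ ν * (polyRootCountMod ![g] (p ^ ν) : ℝ) / (p : ℝ) ^ ν
        ≤ y ^ ν * Cρ / (p : ℝ) ^ ν := by gcongr
      _ = Cρ * (y ^ ν / (p : ℝ) ^ ν) := by ring
  have hgeom : ∀ p : ℕ, p.Prime → 0 ≤ y / p ∧ y / p < 1 ∧ y / p ≤ y / 2 := by
    intro p hp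
    have hp2 : (2 : ℝ) ≤ p := by exact_mod_cast hp.two_le
    have hp0 : (0 : ℝ) < p := by linarith
    refine ⟨by positivity, ?_, ?_⟩
    · rw [div_lt_one hp0]
      linarith
    · exact div_le_div_of_nonneg_left hy0 two_pos hp2
  have hsum : ∀ p : ℕ, p.Prime → Summable (fun ν : ℕ => w (p ^ ν) / (p : ℝ) ^ ν) := by
    intro p hp
    obtain ⟨h0, h1, -⟩ := hgeom p hp
    exact Summable.of_nonneg_of_le (fun ν => div_nonneg (hw0 _) (by positivity)) (hloc p hp)
      ((summable_geometric_of_lt_one h0 h1).mul_left (Cρ : ℝ))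
  -- local factors `≤ exp(y ρ(p)/p + Cρ T₀ / p²)`
  have hfac : ∀ p : ℕ, p.Prime → ∑' ν : ℕ, w (p ^ ν) / (p : ℝ) ^ ν ≤
      Real.exp (y * (polyRootCountMod ![g] p : ℝ) / p + Cρ * T₀ / (p : ℝ) ^ 2) := by
    intro p hp
    obtain ⟨h0, h1, h2⟩ := hgeom p hp
    have hp2 : (2 : ℝ) ≤ p := by exact_mod_cast hp.two_le
    have hp0 : (0 : ℝ) < p := by linarith
    have hs := hsum p hp
    rw [hs.tsum_eq_zero_add, ((summable_nat_add_iff 1).mpr hs).tsum_eq_zero_add]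
    simp only [pow_zero, hw1, div_one, zero_add, pow_one]
    have hwp : w p / p = y * (polyRootCountMod ![g] p : ℝ) / p := by
      simp only [hw]
      rw [ArithmeticFunction.cardFactors_apply_prime hp, pow_one]
    have htail : ∑' ν : ℕ, w (p ^ (ν + 1 + 1)) / (p : ℝ) ^ (ν + 1 + 1) ≤ Cρ * T₀ / (p : ℝ) ^ 2 := by
      have hle2 : ∀ ν : ℕ, w (p ^ (ν + 1 + 1)) / (p : ℝ) ^ (ν + 1 + 1) ≤ Cρ * (y / p) ^ 2 * (y / p) ^ ν := by
        intro ν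
        calc _ ≤ Cρ * (y / p) ^ (ν + 1 + 1) := hloc p hp _
          _ = Cρ * (y / p) ^ 2 * (y / p) ^ ν := by ring
      have hg2 : Summable (fun ν : ℕ => Cρ * (y / p) ^ 2 * (y / p) ^ ν) :=
        (summable_geometric_of_lt_one h0 h1).mul_left _
      calc ∑' ν : ℕ, w (p ^ (ν + 1 + 1)) / (p : ℝ) ^ (ν + 1 + 1)
          ≤ ∑' ν : ℕ, Cρ * (y / p) ^ 2 * (y / p) ^ ν :=
            ((summable_nat_add_iff 2).mpr hs).tsum_le_tsum hle2 hg2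
        _ = Cρ * (y / p) ^ 2 * (1 - y / p)⁻¹ := by rw [tsum_mul_left, tsum_geometric_of_lt_one h0 h1]
        _ ≤ Cρ * (4 / (p : ℝ) ^ 2) * (1 - y / 2)⁻¹ := by
            have hC0 : (0 : ℝ) ≤ Cρ := Nat.cast_nonneg _
            have e1 : (y / p) ^ 2 ≤ 4 / (p : ℝ) ^ 2 := by
              rw [div_pow]
              gcongr
              nlinarith
            have e2 : (1 - y / p)⁻¹ ≤ (1 - y / 2)⁻¹ := by
              rw [inv_le_inv₀ (by linarith) h1y2]
              linarith
            exact mul_le_mul (mul_le_mul_of_nonneg_left e1 hC0) e2 (inv_nonneg.mpr (by linarith)) (by positivity)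
        _ = Cρ * T₀ / (p : ℝ) ^ 2 := by
            rw [hT₀]
            field_simp
    rw [hwp]
    have := Real.add_one_le_exp (y * (polyRootCountMod ![g] p : ℝ) / p + Cρ * T₀ / (p : ℝ) ^ 2)
    linarith
  -- sum of the exponents over `p ≤ N`
  have hexp : ∀ N : ℕ, 2 ≤ N → ∑ p ∈ Nat.primesLE N, (y * (polyRootCountMod ![g] p : ℝ) / p + Cρ * T₀ / (p : ℝ) ^ 2)
      ≤ y * Real.log (Real.log N) + (4 * y - y * b + Cρ * T₀) := by
    intro N hN
    rw [Finset.sum_add_distrib]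
    -- `Σ ρ(p)/p = Σ 1/p − Σ (1 − ρ(p))/p ≤ log log N + 4 − b`
    have hρ : ∑ p ∈ Nat.primesLE N, y * (polyRootCountMod ![g] p : ℝ) / p =
        y * (∑ p ∈ Nat.primesLE N, (1 : ℝ) / p) -
          y * ∑ p ∈ Nat.primesLE N, (((1 : ℕ) : ℝ) - polyRootCountMod ![g] p) / p := by
      rw [Finset.mul_sum, Finset.mul_sum, ← Finset.sum_sub_distrib]
      refine Finset.sum_congr rfl fun p _ => ?_
      push_cast
      ring
    have hA := Literature.NumberTheory.LFunctions.MertensBound.sum_inv_prime_le N hN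
    have hB := hlow N
    -- `Σ 1/p² ≤ Σ 1/(p(p−1)) ≤ 1`
    have hC : ∑ p ∈ Nat.primesLE N, Cρ * T₀ / (p : ℝ) ^ 2 ≤ Cρ * T₀ := by
      have h1 : ∑ p ∈ Nat.primesLE N, 1 / (p : ℝ) ^ 2 ≤ ∑ p ∈ Nat.primesLE N, 1 / ((p : ℝ) * (p - 1)) := by
        refine Finset.sum_le_sum fun p hp => ?_
        have hp2 : (2 : ℝ) ≤ p := by exact_mod_cast (Nat.prime_of_mem_primesLE hp).two_le
        exact div_le_div_of_nonneg_left zero_le_one (by nlinarith) (by nlinarith)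
      have h2 := Literature.NumberTheory.LFunctions.HallTenenbaum.sum_primesLE_inv_mul_pred_le_one N
      have e : ∑ p ∈ Nat.primesLE N, Cρ * T₀ / (p : ℝ) ^ 2 = ∑ p ∈ Nat.primesLE N, Cρ * T₀ * (1 / (p : ℝ) ^ 2) :=
        Finset.sum_congr rfl fun p _ => by ring
      rw [e, ← Finset.mul_sum]
      calc Cρ * T₀ * ∑ p ∈ Nat.primesLE N, 1 / (p : ℝ) ^ 2 ≤ Cρ * T₀ * 1 :=
            mul_le_mul_of_nonneg_left (h1.trans h2) (by positivity)
        _ = Cρ * T₀ := mul_one _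
    rw [hρ]
    nlinarith [mul_le_mul_of_nonneg_left hA hy0, mul_le_mul_of_nonneg_left hB hy0]
  -- assemble
  refine ⟨Real.exp (4 * y - y * b + Cρ * T₀), (Real.exp_pos _).le, fun N hN => ?_⟩
  have hlogN : 0 < Real.log N := Real.log_pos (by exact_mod_cast hN)
  have h04 := Literature.NumberTheory.LFunctions.HallTenenbaum.sum_div_le_prod_tsum hw1 hwmul hw0 hsum N
  have e : ∑ m ∈ Icc 1 N, y ^ cardFactors m * (polyRootCountMod ![g] m : ℝ) / m = ∑ m ∈ Icc 1 N, w m / m :=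
    Finset.sum_congr rfl fun m _ => by simp only [hw]
  rw [e]
  calc ∑ m ∈ Icc 1 N, w m / m ≤ ∏ p ∈ Nat.primesLE N, ∑' ν : ℕ, w (p ^ ν) / (p : ℝ) ^ ν := h04
    _ ≤ ∏ p ∈ Nat.primesLE N, Real.exp (y * (polyRootCountMod ![g] p : ℝ) / p + Cρ * T₀ / (p : ℝ) ^ 2) :=
        Finset.prod_le_prod (fun p _ => tsum_nonneg fun ν => div_nonneg (hw0 _) (by positivity))
          fun p hp => hfac p (Nat.prime_of_mem_primesLE hp)
    _ = Real.exp (∑ p ∈ Nat.primesLE N, (y * (polyRootCountMod ![g] p : ℝ) / p + Cρ * T₀ / (p : ℝ) ^ 2)) := by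
        rw [Real.exp_sum]
    _ ≤ Real.exp (y * Real.log (Real.log N) + (4 * y - y * b + Cρ * T₀)) := Real.exp_le_exp.mpr (hexp N hN)
    _ = Real.exp (4 * y - y * b + Cρ * T₀) * Real.log N ^ y := by
        rw [Real.exp_add, Real.rpow_def_of_pos hlogN, mul_comm]
        ring_nf

/-- **tails_rootCountHarmonic_le** (registered helper of `stub_tails`, line `product-anatomy-subcritical`): along a
Bateman–Horn system and for `1 ≤ y < 2`, every member's tilted harmonic root-count sum is of order `(log N)^y`:
`Σ_{1 ≤ m ≤ N} y^{Ω(m)} ρⱼ(m)/m ≤ C (log N)^y` (`N ≥ 2`, one `C` for all `j`), `ρⱼ = polyRootCountMod ![f j]` — the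
size of the right-hand side of the Nair–Tenenbaum bound for the peeled tilt. [folklore] -/
theorem tails_rootCountHarmonic_le : ∀ (k : ℕ) (f : Fin k → ℤ[X]), IsBatemanHornSystem f → ∀ y : ℝ, 1 ≤ y →
    y < 2 → ∃ C : ℝ, ∀ (j : Fin k) (N : ℕ), 2 ≤ N →
      (∑ m ∈ Icc 1 N, y ^ cardFactors m * (polyRootCountMod ![f j] m : ℝ) / m) ≤ C * Real.log N ^ y := by
  intro k f hf y hy hy2
  choose C hC0 hC using fun j : Fin k => exists_harmonic_rootCount_le_single (BatemanHornMertens.isBatemanHornSystem_single hf j) hy hy2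
  refine ⟨∑ j, C j, fun j N hN => (hC j N hN).trans ?_⟩
  exact mul_le_mul_of_nonneg_right (Finset.single_le_sum (fun i _ => hC0 i) (Finset.mem_univ j))
    (Real.rpow_nonneg (Real.log_natCast_nonneg N) _)

end

end Summit.Parity.BatemanHorn.Cruxes.LSDRealSegment.ProductAnatomySubcritical
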